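import Literature.NumberTheory.Transcendental.Zilber
import Literature.NumberTheory.Transcendental.LindemannWeierstrassProofs
import Literature.NumberTheory.Transcendental.ZilberFieldCCP
import Literature.NumberTheory.Transcendental.ZilberFieldTransport
import HarnessLib

/-!
# Towards Bays–Kirby's Theorem 1.5 (`ℂ_exp` EAC ⟹ quasiminimal): proof architecture

Sibling proof file of `Literature/NumberTheory/Transcendental/Zilber.lean` for the named fact
`Literature.NumberTheory.Transcendental.isQuasiminimal_of_isExpAlgClosed`
(M. Bays, J. Kirby, *Pseudo-exponential maps, variants, and quasiminimality*, Algebra & Number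
Theory 12 (2018) 493–549, arXiv:1512.04262, **Theorem 1.5**: if `ℂ_exp` is
exponentially-algebraically closed then it is quasiminimal).

The printed proof of Theorem 1.5 (loc. cit. §11.2, p. 38: "Since `ℂ_exp` has the countable
closure property by Proposition 10.7, this completes the proof of Theorem 1.5") is the
conjunction of two results:

* **Corollary 11.7.** A *full* Γ-field with the countable closure property which is Γ-closed is
  quasiminimal. In the exponential setting of §9.1 (`k = ℚ`, `G₁ = 𝔾ₐ`, `G₂ = 𝔾ₘ`, `𝒪 = ℤ`,
  `Γ` = graph of `exp`) a full Γ-field is an "ELA-field" (Theorem 9.1, axiom 1: an algebraically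
  closed field of characteristic zero with `exp` a surjective homomorphism `𝔾ₐ(F) → 𝔾ₘ(F)`;
  Definition 3.8), Γ-closedness is exponential-algebraic closedness (Definition 10.3 and the
  remark following it), and the countable closure property is countability of `ecl^F(X)` for
  finite `X` (Theorem 9.1, axiom 5; Remark 10.10). This is vendored here as the named fact
  `Literature.NumberTheory.Transcendental.BaysKirby2018_isQuasiminimal_of_isExpAlgClosed_of_ccp`. Its proof is the body of the
  paper (Γ-fields §3, predimension and the pregeometry `Γcl` §4, amalgamation §5 with the purely
  Γ-transcendental variant Thm 5.21, quasiminimal pregeometry structures §6 with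
  Bays–Hart–Hyttinen–Kesälä–Kirby 2014 Thm 2.3 = Fact 6.4, classification of strong extensions
  §7, axiomatisation Thm 8.2, generic Γ-closedness §11 with the horizontal semiabelian weak
  Zilber–Pink Thm 11.4); none of this is in Mathlib, so it stays a named fact for now.
* **Countable closure property of `ℂ_exp`** (Theorem 1.8 / Proposition 10.7 with Lemma 10.6;
  originally Zilber 2005, Lemma 5.12), already vendored as the named fact
  `Literature.NumberTheory.Transcendental.hasCountableClosureProperty_complex` (`ZilberField.lean`).

together with two facts about `ℂ` that are theorems in the tree: `Complex.isAlgClosed` (Mathlib)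
and `Literature.ModelTheory.ExponentialFields.ExponentialRing.isSurjectiveOntoUnits_complex` (`ExponentialField.lean`).

## Contents

* `Literature.NumberTheory.Transcendental.BaysKirby2018_isQuasiminimal_of_isExpAlgClosed_of_ccp` — named fact, Bays–Kirby 2018
  Cor. 11.7 in the exponential case.
* `Literature.NumberTheory.Transcendental.isQuasiminimal_of_isExpAlgClosed_of_cor_11_7` — **proved**: the assembly step of
  the printed proof of Thm 1.5, reducing `Literature.NumberTheory.Transcendental.isQuasiminimal_of_isExpAlgClosed` to the two
  named facts above.
* `Literature.NumberTheory.Transcendental.hasStandardKernel_complex_holds` — **proved**: discharge of the named fact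
  `Literature.NumberTheory.Transcendental.hasStandardKernel_complex` (`Zilber.lean`; Zilber 2005 §1, Kirby 2013 §2.5:
  `ℂ_exp` satisfies the standard-kernel axiom), from `ker exp = 2πiℤ`
  (`Literature.NumberTheory.Transcendental.hasStandardKernel_complex_of_transcendental_pi`) and Lindemann's theorem
  (`Literature.NumberTheory.Transcendental.transcendental_pi_holds`, `LindemannWeierstrassProofs.lean`).
* `Literature.NumberTheory.Transcendental.zilberConjecture_iff_schanuelConjecture_and_isStronglyExpAlgClosed` —
  **proved**: Bays–Kirby 2018 **Theorem 1.4** ("Conjecture 1.3 is true if and only if Schanuel's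
  conjecture is true and `ℂ_exp` is strongly exponentially-algebraically closed", p. 3), now
  unconditional in the tree because the other four axioms of `IsZilberField ℂ` are theorems:
  `Complex.isAlgClosed`, `isSurjectiveOntoUnits_complex`, `hasStandardKernel_complex_holds`
  (above) and `hasCountableClosureProperty_complex_holds` (`ZilberFieldCCP.lean`). With the
  projections `ZilberConjecture.schanuelConjecture` / `.isStronglyExpAlgClosed`, the converse
  `zilberConjecture_of_schanuelConjecture_of_isStronglyExpAlgClosed`, and Kirby's variant
  `zilberConjecture_iff_schanuelConjecture_and_isLinIndepExpAlgClosed` (SEAC replaced by Kirby's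
  linear-independence scheme, granted the named fact
  `kirby2013_isStronglyExpAlgClosed_iff_isLinIndepExpAlgClosed ℂ`, Kirby 2013 §2.3). This records
  in Lean why the named fact `ZilberConjecture` (Bays–Kirby Conjecture 1.3) has no discharge: it is
  equivalent to the conjunction of two open statements, Schanuel's conjecture (the summit
  `Schanuel`) and SEAC for `ℂ_exp`.

* `Literature.NumberTheory.Transcendental.zilberConjecture_iff_forall_nonempty_equiv_of` — **proved**: the
  **isomorphism form of Zilber's conjecture**, stated explicitly here — Zilber's conjecture
  `IsZilberField ℂ` ↔ "every Zilber field of cardinality `𝔠` is E-ring isomorphic to `ℂ_exp`"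
  (Bays–Kirby 2018 Conjecture 1.3, "`ℂ_exp` is isomorphic to the unique model `𝔹` of
  `ECF_{SK,CCP}` of cardinality continuum", read through Theorem 1.2) — granted exactly the two
  named facts of `ZilberField.lean` that make up Theorem 1.2: Zilber's categoricity theorem
  `zilber_categoricity` (direction `→`, `forall_nonempty_equiv_of_zilberConjecture`) and Zilber's
  existence theorem `exists_isZilberField_of_aleph0_lt` (direction `←`,
  `zilberConjecture_of_forall_nonempty_equiv`), together with the transport of Zilber's axioms
  along E-ring isomorphisms, proved in `ZilberFieldTransport.lean`
  (`IsZilberField.of_exponentialRingEquiv`). Both halves of Theorem 1.2 are genuinely used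
  (`→` *is* categoricity in cardinality `𝔠` relative to `ℂ_exp`; `←` is vacuous unless a Zilber
  field of cardinality `𝔠` exists), so the equivalence is not recorded as a separate named fact:
  its only proof obligation is that of `zilber_categoricity` and
  `exists_isZilberField_of_aleph0_lt` (Zilber 2005 Thm 1.1 = Bays–Kirby 2018 Thm 1.2), and the
  unconditional equivalence is `zilberConjecture_iff_forall_nonempty_equiv_of
  zilber_categoricity_holds exists_isZilberField_of_aleph0_lt_holds` once those land (D-0026
  split review 2026-08-15: the former `def … : Prop` of the same statement in `Zilber.lean` is
  merged into this theorem). Unconditionally,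
  `Literature.NumberTheory.Transcendental.zilberConjecture_iff_exists_nonempty_equiv` — **proved**:
  `ℂ_exp` is a Zilber field iff it is E-ring isomorphic to *some* Zilber field of cardinality `𝔠`.

## Faithfulness notes

* Bays–Kirby state quasiminimality for the structure `⟨F; +, ·, exp⟩` (Conjecture 1.1, Thm 9.1),
  which is `Language.expRing.IsQuasiminimal F` (`ZilberField.lean`): every subset of `F`
  definable with parameters is countable or co-countable.
* `Literature.NumberTheory.Transcendental.IsExpAlgClosed` is the single-point form of Γ-closedness ("Using the classical Rabinovich
  trick, one can easily show this axiom scheme is equivalent to the existence of a single point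
  `β ∈ V(F) ∩ Γ(F)ⁿ`, for every such `V`. For the usual exponentiation, Γ-closedness is known as
  exponential-algebraic closedness", p. 33 after Def. 10.3); rotundity and freeness
  (`Literature.NumberTheory.Transcendental.IsRotund`, `Literature.NumberTheory.Transcendental.IsAddFree`, `Literature.NumberTheory.Transcendental.IsMulFree`) are Def. 7.1 with `d = 1`, `𝒪 = ℤ`.
* `Literature.HasCountableClosureProperty F` asks `ecl^F(A)` countable for *countable* `A`; Bays–Kirby's
  axiom 5 asks it for finite `X`. The countable form trivially implies the finite one, so the
  vendored fact is (at worst) a specialisation of Cor. 11.7, never stronger than the source.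
* No hypothesis on `ker exp` and no Schanuel property appear in Cor. 11.7 ("Schanuel's conjecture
  is not required as a condition for quasiminimality", abstract); the countable Γ-closed base
  `K ◁ F` of Thm 11.6 is supplied by the countable closure property.

## References

* M. Bays, J. Kirby, *Pseudo-exponential maps, variants, and quasiminimality*, Algebra & Number
  Theory 12:3 (2018) 493–549, doi:10.2140/ant.2018.12.493, arXiv:1512.04262 — Conjecture 1.3,
  Thm 1.4, Thm 1.5 (p. 3), Thm 9.1 (p. 28, the axioms `ECF_{SK,CCP}`),
  Def. 3.8, Def. 7.1, Thm 9.1, Def. 10.3, Prop. 10.7, Remark 10.10, Thm 11.6, Cor. 11.7 (p. 38).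
* B. Zilber, *Pseudo-exponentiation on algebraically closed fields of characteristic zero*,
  Ann. Pure Appl. Logic 132 (2005) 67–95, Lemma 5.12.
* M. Bays, B. Hart, T. Hyttinen, M. Kesälä, J. Kirby, *Quasiminimal structures and excellence*,
  Bull. LMS 46 (2014) 155–163, Thm 2.3.
* J. Kirby, *A note on the axioms for Zilber's pseudo-exponential fields*, Notre Dame J. Formal
  Logic 54 (2013) 509–520, arXiv:1006.0894 — §2 axiom 2 (p. 4), §2.3 Proposition (p. 4–5),
  §2.5 (p. 5).
-/

noncomputable section

open FirstOrder

namespace Literature.NumberTheory.Transcendental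

/-- **Bays–Kirby 2018, Corollary 11.7** (exponential case of §9.1: `k = ℚ`, `G₁ = 𝔾ₐ`,
`G₂ = 𝔾ₘ`, `𝒪 = ℤ`, `Γ` the graph of `exp`). Let `F` be an exponential field of characteristic
zero which is a *full* Γ-field — `F` is algebraically closed and `exp : F → Fˣ` is surjective
(Def. 3.8; "ELA-field", Thm 9.1 axiom 1) — which has the countable closure property
(`ecl^F(X)` countable, Thm 9.1 axiom 5 and Remark 10.10; here in the form
`Literature.NumberTheory.Transcendental.HasCountableClosureProperty`, for countable `X`, which implies the finite form) and which is
exponentially-algebraically closed (= Γ-closed, Def. 10.3, in the equivalent single-point form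
`Literature.NumberTheory.Transcendental.IsExpAlgClosed`). Then `F` is quasiminimal: every subset of `F` definable with parameters in
`⟨F; +, ·, exp⟩` is countable or co-countable. Neither a standard kernel nor the Schanuel property
is assumed. (Proof in print: Thm 11.6 with `K = Γcl^F(∅)`, via the purely Γ-transcendental
amalgamation Thm 5.21, Thm 6.9, Fact 6.4 = Bays–Hart–Hyttinen–Kesälä–Kirby 2014 Thm 2.3,
Props 11.2 and 11.5.) [cite: BaysKirby2018ANT, Cor 11.7] -/
def BaysKirby2018_isQuasiminimal_of_isExpAlgClosed_of_ccp : Prop :=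
  ∀ {F : Type*} [Field F] [CharZero F] [Literature.ModelTheory.ExponentialFields.ExponentialRing F],
    IsAlgClosed F → Literature.ModelTheory.ExponentialFields.ExponentialRing.IsSurjectiveOntoUnits F →
      HasCountableClosureProperty F → IsExpAlgClosed F → Literature.ModelTheory.ExponentialFields.Language.expRing.IsQuasiminimal F

end Literature.NumberTheory.Transcendental

namespace Literature.NumberTheory.Transcendental

/-- **Assembly step of Bays–Kirby 2018, Theorem 1.5** (p. 38: "Since `ℂ_exp` has the countable
closure property by Proposition 10.7, this completes the proof of Theorem 1.5"): granted
Corollary 11.7 in the exponential case (`Literature.NumberTheory.Transcendental.BaysKirby2018_isQuasiminimal_of_isExpAlgClosed_of_ccp`)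
and the countable closure property of `ℂ_exp` (`Literature.NumberTheory.Transcendental.hasCountableClosureProperty_complex`,
Zilber 2005 Lemma 5.12 = Bays–Kirby Prop. 10.7), the named fact
`Literature.NumberTheory.Transcendental.isQuasiminimal_of_isExpAlgClosed` follows, because `ℂ_exp` is a full Γ-field:
`ℂ` is algebraically closed (`Complex.isAlgClosed`) and `exp` is onto `ℂˣ`
(`Literature.ModelTheory.ExponentialFields.ExponentialRing.isSurjectiveOntoUnits_complex`). [cite: BaysKirby2018ANT, Thm 1.5] -/
theorem isQuasiminimal_of_isExpAlgClosed_of_cor_11_7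
    (hcor : BaysKirby2018_isQuasiminimal_of_isExpAlgClosed_of_ccp.{0})
    (hccp : hasCountableClosureProperty_complex) :
    isQuasiminimal_of_isExpAlgClosed :=
  fun hEAC => hcor Complex.isAlgClosed Literature.ModelTheory.ExponentialFields.ExponentialRing.isSurjectiveOntoUnits_complex hccp hEAC

end Literature.NumberTheory.Transcendental

/-! ### The standard kernel of `ℂ_exp` -/

namespace Literature.NumberTheory.Transcendental

/-- **`ℂ_exp` has standard kernel** — discharge of the named fact
`Literature.NumberTheory.Transcendental.hasStandardKernel_complex` (Zilber 2005 §1, axiom "`ker = ωℤ`, `ω` transcendental",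
for `ℂ_exp` with `ω = 2πi`; Kirby 2013 §2.5, p. 5: "Axioms 1 and 2 are chosen such that `ℂ_exp`
satisfies them"): `ker exp = 2πiℤ` by `Complex.exp_eq_one_iff`
(`Literature.NumberTheory.Transcendental.hasStandardKernel_complex_of_transcendental_pi`), and `2πi` is transcendental because `π` is
— Lindemann's theorem, proved in the tree as `Literature.NumberTheory.Transcendental.transcendental_pi_holds`.
[cite: Zilber2005PseudoExp, §1] [cite: Kirby2013Axioms, §2.5, p. 5] -/
theorem hasStandardKernel_complex_holds : hasStandardKernel_complex :=
  hasStandardKernel_complex_of_transcendental_pi transcendental_pi_holds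

end Literature.NumberTheory.Transcendental

/-! ### Bays–Kirby 2018, Theorem 1.4: Zilber's conjecture ↔ Schanuel's conjecture ∧ SEAC -/

namespace Literature.NumberTheory.Transcendental

/-- **Zilber's conjecture implies Schanuel's conjecture** (Bays–Kirby 2018, Theorem 1.4,
direction `⟹`; Zilber 2005 §1: the Schanuel property is axiom (SP) of pseudo-exponentiation).
The projection `IsZilberField.schanuelProperty` at `K = ℂ`; `SchanuelProperty ℂ` is Schanuel's
conjecture (**periods.S09**: the summit statement `Schanuel` = `Literature.Periods.SchanuelConjecture`
unfolds to it by `Iff.rfl`, cf. `Summits/Schanuel/Schanuel/Theorems/EclCoreAssembly.lean`). [cite: BaysKirby2018ANT, Thm 1.4] [cite: Zilber2005PseudoExp, §1] -/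
theorem ZilberConjecture.schanuelConjecture (h : ZilberConjecture) :
    Literature.ModelTheory.ExponentialFields.SchanuelProperty ℂ :=
  IsZilberField.schanuelProperty h

/-- **Zilber's conjecture implies strong exponential-algebraic closedness of `ℂ_exp`**
(Bays–Kirby 2018, Theorem 1.4, direction `⟹`; the projection `IsZilberField.isStronglyExpAlgClosed`
at `K = ℂ`). [cite: BaysKirby2018ANT, Thm 1.4] -/
theorem ZilberConjecture.isStronglyExpAlgClosed (h : ZilberConjecture) :
    IsStronglyExpAlgClosed ℂ :=
  IsZilberField.isStronglyExpAlgClosed h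

/-- **Schanuel's conjecture and SEAC imply Zilber's conjecture** (Bays–Kirby 2018, Theorem 1.4,
direction `⟸`: "there are two algebraic axioms which are obviously true in `ℂ_exp` and then three
more axioms: Schanuel's conjecture, strong exponential-algebraic closedness, and the countable
closure property ... Zilber proved the countable closure property for `ℂ_exp`", p. 3). The four
remaining axioms of `IsZilberField ℂ` are theorems of the tree: `ℂ` is algebraically closed
(`Complex.isAlgClosed`), `exp` is onto `ℂˣ`
(`Literature.ModelTheory.ExponentialFields.ExponentialRing.isSurjectiveOntoUnits_complex`), the
kernel is standard (`hasStandardKernel_complex_holds`, Lindemann) and `ℂ_exp` has the countable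
closure property (`hasCountableClosureProperty_complex_holds`, Zilber 2005 Lemma 5.12 =
Bays–Kirby Prop. 10.7). [cite: BaysKirby2018ANT, Thm 1.4] [cite: Zilber2005PseudoExp, Lemma 5.12] -/
theorem zilberConjecture_of_schanuelConjecture_of_isStronglyExpAlgClosed
    (hSC : Literature.ModelTheory.ExponentialFields.SchanuelProperty ℂ) (hSEAC : IsStronglyExpAlgClosed ℂ) :
    ZilberConjecture := by
  show IsZilberField ℂ
  exact
    { isAlgClosed := Complex.isAlgClosed
      hasStandardKernel := hasStandardKernel_complex_holds
      isSurjectiveOntoUnits :=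
        Literature.ModelTheory.ExponentialFields.ExponentialRing.isSurjectiveOntoUnits_complex
      schanuelProperty := hSC
      isStronglyExpAlgClosed := hSEAC
      hasCountableClosureProperty := hasCountableClosureProperty_complex_holds }

/-- **Bays–Kirby 2018, Theorem 1.4** ("Conjecture 1.3 is true if and only if Schanuel's
conjecture is true and `ℂ_exp` is strongly exponentially-algebraically closed", p. 3), proved:
Zilber's conjecture `ZilberConjecture` (`IsZilberField ℂ`, Conjecture 1.3 via the categoricity
Theorem 1.2) is equivalent to the conjunction of Schanuel's conjecture (`SchanuelProperty ℂ`, to which the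
summit statement `Schanuel` unfolds by `Iff.rfl`) and strong exponential-algebraic closedness of `ℂ_exp`
(`IsStronglyExpAlgClosed ℂ`), the other four axioms of Theorem 9.1 being theorems for `ℂ_exp`
(`zilberConjecture_of_schanuelConjecture_of_isStronglyExpAlgClosed`). Both conjuncts are open
(loc. cit.: "Schanuel's conjecture is considered out of reach"), which is why the named fact
`ZilberConjecture` has no discharge in the tree. [cite: BaysKirby2018ANT, Thm 1.4] -/
theorem zilberConjecture_iff_schanuelConjecture_and_isStronglyExpAlgClosed :
    ZilberConjecture ↔
      Literature.ModelTheory.ExponentialFields.SchanuelProperty ℂ ∧ IsStronglyExpAlgClosed ℂ :=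
  ⟨fun h => ⟨h.schanuelConjecture, h.isStronglyExpAlgClosed⟩,
    fun h => zilberConjecture_of_schanuelConjecture_of_isStronglyExpAlgClosed h.1 h.2⟩

/-- **Theorem 1.4 with Kirby's scheme in place of SEAC** (Kirby 2013, §2.3, Proposition: "Axiom 4,
SEAC, is first-order expressible modulo axioms 1, 2, and 3", proof: "Thus axiom 4 is equivalent to
this scheme, modulo axioms 1, 2, and 3"). Granted Kirby's equivalence for `ℂ_exp` (the named fact
`kirby2013_isStronglyExpAlgClosed_iff_isLinIndepExpAlgClosed ℂ`), Zilber's conjecture is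
equivalent to Schanuel's conjecture together with Kirby's linear-independence scheme
`IsLinIndepExpAlgClosed ℂ` (solutions `ℚ`-linearly independent over `ā` instead of generic), since
axioms 1 and 2 hold in `ℂ_exp` (Kirby 2013 §2.5: "Axioms 1 and 2 are chosen such that `ℂ_exp`
satisfies them") and axiom 3 is the Schanuel conjunct. The direction `⟹` is unconditional
(`IsZilberField.isLinIndepExpAlgClosed`). [cite: Kirby2013Axioms, §2.3, Proposition] [cite: BaysKirby2018ANT, Thm 1.4] -/
theorem zilberConjecture_iff_schanuelConjecture_and_isLinIndepExpAlgClosed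
    (hK : kirby2013_isStronglyExpAlgClosed_iff_isLinIndepExpAlgClosed ℂ) :
    ZilberConjecture ↔
      Literature.ModelTheory.ExponentialFields.SchanuelProperty ℂ ∧ IsLinIndepExpAlgClosed ℂ := by
  refine ⟨fun h => ⟨h.schanuelConjecture, IsZilberField.isLinIndepExpAlgClosed h⟩, fun h => ?_⟩
  exact IsZilberField.of_isLinIndepExpAlgClosed hK Complex.isAlgClosed
    hasStandardKernel_complex_holds
    Literature.ModelTheory.ExponentialFields.ExponentialRing.isSurjectiveOntoUnits_complex h.1 h.2
    hasCountableClosureProperty_complex_holds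

end Literature.NumberTheory.Transcendental

/-! ### The isomorphism form of Zilber's conjecture (Bays–Kirby 2018, Conjecture 1.3 via Theorem 1.2)

Bays–Kirby 2018, p. 3: **Theorem 1.2.** "Up to isomorphism there is exactly one model of the
axioms `ECF_{SK,CCP}` of each uncountable cardinality, and it is quasiminimal." (Zilber 2005,
Thm 1.1.) **Conjecture 1.3.** "`ℂ_exp` is isomorphic to the unique model `𝔹` of `ECF_{SK,CCP}`
of cardinality continuum." The tree states Zilber's conjecture as `ZilberConjecture :=
IsZilberField ℂ` ("`ℂ_exp ⊨ ECF_{SK,CCP}`", the axioms of Thm 9.1). The three theorems below prove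
its equivalence with the isomorphism form "every Zilber field of cardinality `𝔠` is E-ring
isomorphic to `ℂ_exp`" (`zilberConjecture_iff_forall_nonempty_equiv_of`, statement spelled out)
from the existence and uniqueness halves of Theorem 1.2, which are the named facts
`exists_isZilberField_of_aleph0_lt` and `zilber_categoricity` of `ZilberField.lean`, and the
(proved) invariance of the axioms under E-ring isomorphisms,
`IsZilberField.of_exponentialRingEquiv` (`ZilberFieldTransport.lean`). -/

namespace Literature.NumberTheory.Transcendental

open Cardinal

/-- **Zilber's conjecture ⟹ the isomorphism form**, granted Zilber's categoricity theorem
(Zilber 2005, Thm 1.1; Bays–Kirby 2018, Thm 1.2, uniqueness half, the named fact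
`zilber_categoricity`): if `ℂ_exp` is a Zilber field then every Zilber field `B` of cardinality
`𝔠 = #ℂ` (`Cardinal.mk_complex`), an uncountable cardinal (`Cardinal.aleph0_lt_continuum`), is
E-ring isomorphic to `ℂ_exp`. [cite: BaysKirby2018ANT, Thm 1.2 and Conjecture 1.3]
[cite: Zilber2005PseudoExp, Thm 1.1] -/
theorem forall_nonempty_equiv_of_zilberConjecture (hcat : zilber_categoricity)
    (h : ZilberConjecture) (B : Type) [Field B] [CharZero B]
    [Literature.ModelTheory.ExponentialFields.ExponentialRing B] (hB : IsZilberField B)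
    (hcard : #B = 𝔠) : Nonempty (ExponentialRingEquiv B ℂ) :=
  hcat hB h (hcard.trans Cardinal.mk_complex.symm) (hcard ▸ Cardinal.aleph0_lt_continuum)

/-- **The isomorphism form ⟹ Zilber's conjecture**, granted Zilber's existence theorem
(Zilber 2005, Thm 1.1; Bays–Kirby 2018, Thm 1.2, existence half, the named fact
`exists_isZilberField_of_aleph0_lt`): there is a Zilber field `B` of cardinality `𝔠`; by
hypothesis it is E-ring isomorphic to `ℂ_exp`, and Zilber's axioms are transported along the
isomorphism (`IsZilberField.of_exponentialRingEquiv`), so `ℂ_exp` is a Zilber field.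
[cite: BaysKirby2018ANT, Thm 1.2 and Conjecture 1.3] [cite: Zilber2005PseudoExp, Thm 1.1] -/
theorem zilberConjecture_of_forall_nonempty_equiv (hex : exists_isZilberField_of_aleph0_lt)
    (h : ∀ (B : Type) [Field B] [CharZero B]
      [Literature.ModelTheory.ExponentialFields.ExponentialRing B],
      IsZilberField B → #B = 𝔠 → Nonempty (ExponentialRingEquiv B ℂ)) :
    ZilberConjecture := by
  obtain ⟨B, _, _, _, hB, hcard⟩ := hex 𝔠 Cardinal.aleph0_lt_continuum
  obtain ⟨e⟩ := h B hB hcard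
  exact hB.of_exponentialRingEquiv e

/-- **periods.S30, isomorphism form: Zilber's conjecture ↔ "`ℂ_exp ≅ 𝔹`", granted Zilber's
categoricity and existence theorems** (Bays–Kirby 2018, Conjecture 1.3 "`ℂ_exp` is isomorphic to
the unique model `𝔹` of `ECF_{SK,CCP}` of cardinality continuum" read through Theorem 1.2 "Up to
isomorphism there is exactly one model of the axioms `ECF_{SK,CCP}` of each uncountable
cardinality"; Zilber 2005, Thm 1.1 and the Conjecture on p. 68): granted the two named facts
`zilber_categoricity` and `exists_isZilberField_of_aleph0_lt` (the uniqueness and existence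
halves of Theorem 1.2), Zilber's conjecture `ZilberConjecture` (`IsZilberField ℂ`) is equivalent
to "every Zilber field `B` of cardinality continuum is E-ring isomorphic to `ℂ_exp`" (`B : Type`,
the universe of `zilber_categoricity`). `→` is `forall_nonempty_equiv_of_zilberConjecture`
(categoricity with `#ℂ = 𝔠`, `Cardinal.mk_complex`); `←` is
`zilberConjecture_of_forall_nonempty_equiv` (existence at `κ = 𝔠` and the invariance of the
axioms under E-ring isomorphisms, `IsZilberField.of_exponentialRingEquiv`). This theorem *is* the
tree's statement of the isomorphism form (no separate named fact: both halves of Theorem 1.2 are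
genuinely needed, so its proof obligation is exactly theirs); the unconditional equivalence is
`zilberConjecture_iff_forall_nonempty_equiv_of zilber_categoricity_holds
exists_isZilberField_of_aleph0_lt_holds` once those two theorems of Zilber are formalised, and
the existential variant `zilberConjecture_iff_exists_nonempty_equiv` below is unconditional.
[cite: BaysKirby2018ANT, Thm 1.2 and Conjecture 1.3] [cite: Zilber2005PseudoExp, Thm 1.1 and Conjecture p. 68] -/
theorem zilberConjecture_iff_forall_nonempty_equiv_of (hcat : zilber_categoricity)
    (hex : exists_isZilberField_of_aleph0_lt) :
    ZilberConjecture ↔ ∀ (B : Type) [Field B] [CharZero B]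
      [Literature.ModelTheory.ExponentialFields.ExponentialRing B],
      IsZilberField B → #B = 𝔠 → Nonempty (ExponentialRingEquiv B ℂ) :=
  ⟨fun h B _ _ _ hB hcard => forall_nonempty_equiv_of_zilberConjecture hcat h B hB hcard,
    zilberConjecture_of_forall_nonempty_equiv hex⟩

/-- **The existential isomorphism form, unconditionally.** `ℂ_exp` is a Zilber field iff it is
E-ring isomorphic to *some* Zilber field of cardinality continuum: `→` with `B = ℂ` itself
(`#ℂ = 𝔠`, `Cardinal.mk_complex`, and the identity isomorphism), `←` by transport of the axioms
(`IsZilberField.of_exponentialRingEquiv`). This is the part of Bays–Kirby's Conjecture 1.3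
("`ℂ_exp` is isomorphic to the unique model `𝔹` of `ECF_{SK,CCP}` of cardinality continuum")
that does not depend on Theorem 1.2; uniqueness of `𝔹` is what `zilber_categoricity` adds in
`zilberConjecture_iff_forall_nonempty_equiv_of`. [cite: BaysKirby2018ANT, Conjecture 1.3] -/
theorem zilberConjecture_iff_exists_nonempty_equiv :
    ZilberConjecture ↔ ∃ (B : Type) (_ : Field B) (_ : CharZero B)
      (_ : Literature.ModelTheory.ExponentialFields.ExponentialRing B),
      IsZilberField B ∧ #B = 𝔠 ∧ Nonempty (ExponentialRingEquiv B ℂ) := by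
  constructor
  · intro h
    exact ⟨ℂ, inferInstance, inferInstance, inferInstance, h, Cardinal.mk_complex,
      ⟨ExponentialRingEquiv.refl ℂ⟩⟩
  · rintro ⟨B, _, _, _, hB, -, ⟨e⟩⟩
    exact hB.of_exponentialRingEquiv e

end Literature.NumberTheory.Transcendental
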